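import Summits.BirchSwinnertonDyer.Rank1Residual.X11b.ChaPairsMinimality
import Summits.BirchSwinnertonDyer.Rank1Residual.X1.CongruenceTransfer
import Summits.BirchSwinnertonDyer.Rank1Residual.Partition.EisensteinKernelCertificate
import Literature.NumberTheory.EllipticCurves.Fisher2012.HesseFamilyThreeReverseProofs
import Literature.NumberTheory.EllipticCurves.Rank1Residual.GVParityTwistProofs
import HarnessLib

/-!
# Route G at a split Eisenstein `3`, pair `31974i1 ← 219b1`: the GALOIS SIDE in the kernel
# (`31974i1[3] ≅ 219b1[3]` by Fisher's reverse Hesse certificate; `31974i1[3]` reducible) — cell `bsd-eis`,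
# seat `bsd-eis-ky` gen 4, after the planner's farm-checked sketch `HOME/plan-g8/TorsionIso31974i1Certs.lean`
# (FINDING F5′-bis); THEOREMS ONLY, nothing booked

HONEST FRAMING (FULL-BSD rank-≤1 programme D-0033, cell `bsd-eis`, row A10-split: 83 cells `(E₀, 3)`,
`r = 0`, split multiplicative Eisenstein `3`, `¬GVPar`). The route-G display for the target
`W = 31974i1 = [1,0,1,−8105,−20083228]` from its λ-minimal relative `W' = 219b1 = [0,1,1,3,2]`
(`X2/RouteGSplitDisplay31974i1.lean`, this seat) takes two Galois-side per-pair hypotheses, `hiso :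
TorsionIso W W' 3` (`E₀[3] ≅ E₀'[3]` as `Γ_ℚ`-modules) and `hred : ¬Irr(E₀[3])`. Both are THEOREMS here, so
that the display's only per-pair binders are INSTRUMENT certificates (`r_an`, `(μ, λ)_an`):
* `torsionIso_31974i1_219b1` — by the REVERSE (anti-symplectic, `X_E⁻(3)`) `n = 3` Hesse family of Fisher
  2012, PROVED in the tree (`Fisher2012.threeCongruent_of_dualHesseCertificate_unconditional`, resting on
  `thm132rev_threeCongruent_dualHessePencil_holds`): in the dual pencil of `219b1` (`c₄ = −128`,
  `c₆ = −1144`, `Δ′ = c₄³ − c₆² = −3405888`) the row `(l : m) = (−14 : 1)` satisfies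
  `−𝔇(−14,1)/(4Δ′) = u⁴·c₄(31974i1)`, `−𝔠₆(−14,1)/(8Δ′²) = u⁶·c₆(31974i1)` with `u = 1/146`
  (`c₄(31974i1) = 389017 = 73³`, `c₆ = 17351325251`); the direct family has no rational point over this
  pair (cube test fails; planner `HOME/plan-g8/x3e_cert2.py`);
* `not_irreducible_31974i1` — `x₀ = 444` is a rational root of `Ψ₃` with `Ψ₂Sq(444) = 255584169 = 15987² ≠ 0`,
  so `E₀[3]` contains a rational line (`KernelDisc.exists_isRationalLine_of_eval_Ψ₃_eq_zero`).
NOT: nothing about `r_an` or `(μ, λ)_an` (instrument certificates, no kernel road); nothing booked.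
References: [Fisher2012Hessian] §13 (the `X_E⁻(3)` analogue of Thm. 13.2); [SilvermanAEC2009] III.1;
HOME/TARGET.md §1.2 ROUTING v1.8.2 (2).
-/

set_option autoImplicit false

noncomputable section

open WeierstrassCurve Literature.NumberTheory.EllipticCurves
  Literature.NumberTheory.EllipticCurves.Fisher2012
  Literature.NumberTheory.EllipticCurves.Rank1Residual
  Summit.BirchSwinnertonDyer.Rank1Residual
  Summit.BirchSwinnertonDyer.Rank1Residual.X1.CongruenceTransfer

namespace Summit.BirchSwinnertonDyer.Rank1Residual.X2.RouteGSplitDisplay31974i1Certs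

/-- `31974i1 = [1,0,1,−8105,−20083228]` is elliptic (`Δ = −174195379849121496 = −2³·3³·73⁸ ≠ 0`). [folklore] -/
theorem isElliptic_31974i1 : (⟨1, 0, 1, -8105, -20083228⟩ : WeierstrassCurve ℚ).IsElliptic :=
  X11b.isElliptic_of_discOf_ne_zero 1 0 1 (-8105) (-20083228) (by decide +kernel)

/-- **`31974i1[3] ≅ 219b1[3]` as `Γ_ℚ`-modules — IN THE KERNEL, reverse kind.** In the dual `n = 3`
Hesse pencil of `219b1` (`c₄ = −128`, `c₆ = −1144`) the row `(l : m) = (−14 : 1)` has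
`−𝔇(−14,1)/(4Δ′) = u⁴·c₄(31974i1)` and `−𝔠₆(−14,1)/(8Δ′²) = u⁶·c₆(31974i1)` with `u = 1/146`,
`Δ′ = c₄³ − c₆² = −3405888`; Fisher 2012 §13 (reverse family, PROVED in the tree) gives the equivariant
isomorphism. Discharges the route-G binder `hiso : TorsionIso 31974i1 219b1 3`.
[cite: Fisher2012Hessian, §13 (X_E⁻(3) analogue of Thm. 13.2)] -/
theorem torsionIso_31974i1_219b1 :
    TorsionIso (⟨1, 0, 1, -8105, -20083228⟩ : WeierstrassCurve ℚ) ⟨0, 1, 1, 3, 2⟩ 3 := by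
  haveI := isElliptic_31974i1
  haveI : (⟨0, 1, 1, 3, 2⟩ : WeierstrassCurve ℚ).IsElliptic :=
    X11b.isElliptic_of_discOf_ne_zero 0 1 1 3 2 (by decide +kernel)
  have hc₄' : (⟨0, 1, 1, 3, 2⟩ : WeierstrassCurve ℚ).c₄ = -128 := by
    norm_num [WeierstrassCurve.c₄, WeierstrassCurve.b₂, WeierstrassCurve.b₄]
  have hc₆' : (⟨0, 1, 1, 3, 2⟩ : WeierstrassCurve ℚ).c₆ = -1144 := by
    norm_num [WeierstrassCurve.c₆, WeierstrassCurve.b₂, WeierstrassCurve.b₄, WeierstrassCurve.b₆]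
  have hc₄ : (⟨1, 0, 1, -8105, -20083228⟩ : WeierstrassCurve ℚ).c₄ = 389017 := by
    norm_num [WeierstrassCurve.c₄, WeierstrassCurve.b₂, WeierstrassCurve.b₄]
  have hc₆ : (⟨1, 0, 1, -8105, -20083228⟩ : WeierstrassCurve ℚ).c₆ = 17351325251 := by
    norm_num [WeierstrassCurve.c₆, WeierstrassCurve.b₂, WeierstrassCurve.b₄, WeierstrassCurve.b₆]
  exact threeCongruent_of_dualHesseCertificate_unconditional ⟨0, 1, 1, 3, 2⟩ ⟨1, 0, 1, -8105, -20083228⟩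
    (-14) 1 (1 / 146) (by norm_num)
    (by rw [eval_hesseD3, hc₄', hc₆', hc₄]; norm_num)
    (by rw [eval_hesseC6three, hc₄', hc₆', hc₆]; norm_num)

/-- **`31974i1[3]` is reducible — IN THE KERNEL**: `x₀ = 444` is a rational root of `Ψ₃` with
`Ψ₂Sq(444) = 255584169 = 15987² ≠ 0`, so `(444, y)` spans a rational `3`-line. Discharges the route-G
binder `hred`. [folklore] -/
theorem not_irreducible_31974i1 :
    ¬ (⟨1, 0, 1, -8105, -20083228⟩ : WeierstrassCurve ℚ).HasIrreducibleModPGaloisRep 3 := by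
  haveI := isElliptic_31974i1
  obtain ⟨Φ, P, y, h, hΦ, -⟩ :=
    KernelDisc.exists_isRationalLine_of_eval_Ψ₃_eq_zero (W := ⟨1, 0, 1, -8105, -20083228⟩) 444
      (by norm_num [WeierstrassCurve.Ψ₃, WeierstrassCurve.b₂, WeierstrassCurve.b₄, WeierstrassCurve.b₆,
            WeierstrassCurve.b₈])
      (by rw [KernelDisc.eval_Ψ₂Sq]; norm_num [WeierstrassCurve.b₂, WeierstrassCurve.b₄, WeierstrassCurve.b₆])
  exact not_hasIrreducibleModPGaloisRep_of_isRationalLine hΦ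

end Summit.BirchSwinnertonDyer.Rank1Residual.X2.RouteGSplitDisplay31974i1Certs

end
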